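import Summits.Ventures.CertifiedManyBodySolver.Observables.RungLeavesSummit
import Summits.HubbardSuperconductivity.HubbardSuperconductivity.Theses.AbsenceCertificate
import HarnessLib

/-!
# Ventures/CertifiedManyBodySolver — Observables/StripePointBridge.lean

HONEST FRAMING: first certified bounds on pairing observables; not a superconductivity verdict; every number certified (two
lineages + referee) or labelled float. hubbard-obs cell (D-0042), obs-lit seat; zero compute; theorem-only; no new named leaf.

**The D59 bearing, typed.** Route `AbsenceCertificate` of `HubbardSuperconductivity` carries the support item
`StripePointCeiling` (stmt-HubbardSuperconductivity-9492): every admissible ground-state sequence at the stripe point `(U, δ) = (8, 1/8)`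
(`N_L = 2⌊(7/8)L²/2⌋`, even `L`) has Scalapino constant `c ≤ 1/200`, i.e. every EVENTUAL lower bound `c·L⁴ ≤ Re⟨ψ_L, P†P ψ_L⟩` along the
even sides has `c ≤ 1/200` (`P = pairField g_d L`). The hubbard-obs summit-format leaf `M3ObsPairLROCeilingAt_tp0 c'`
(Observables/RungLeavesSummit.lean, p405736: `liminf_k (2k)⁻⁴ Re⟨ψ_{2k}, P†P ψ_{2k}⟩ ≤ c'` for every family of unit `(rectN (7/8) L, S^z = 0)`-sector
ground states of `hubbardTorusTT' L 1 0 8 = hubbardTorus 2 L 1 8`) IMPLIES it as soon as `c' ≤ 1/200`: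
`stripePointCeiling_of_pairLROCeilingAt`. Hence ANY certified `F₂`-type `D₄`-orbit cell with `−q/|B|² ≤ 1/200` discharges the route item
(`stripePointCeiling_of_orbitRow`, via `M3ObsPairLROCeilingAt_tp0_of_orbitRow`, p405359 inside) — CONDITIONAL ONLY ON THE CLAIM NODES fed in.
Ingredients: odd sides are immaterial (the leaf quantifies over all-`L` families; an admissible even-`L` family is completed by unit sector
ground states at odd `L`, `exists_unit_isGroundStateInSector_rectN`); the `liminf` is an honest one because the LRO sequence is bounded
(`pairFieldCorr_succ_le`: `|Λ|⁻² ΣΣ P_d ≤ C_g²` for unit vectors), so an eventual lower bound `c ≤ u_k` passes to `c ≤ liminf u`.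
HONEST: tonight's certified ceilings are `c' ≈ 0.3–1.2 ≫ 1/200`; this file makes the bearing a one-line implication, it does not move it.
References: D. J. Scalapino, Phys. Rep. 250 (1995) 329, §2 eq. (2.4) [Scalapino1995]; Qin et al., PRX 10 (2020) 031016 [QinEtAl2020].
-/

noncomputable section

namespace Summit.Ventures.CertifiedManyBodySolver.Observables

open Matrix Finset Literature.MathematicalPhysics.QuantumLattice Literature.Probability.LatticeModels
open Literature.MathematicalPhysics.QuantumLattice.HubbardWave0 ThermodynamicLimit Filter Topology
open Summit.HubbardSuperconductivity.HubbardSuperconductivity.Theses.AbsenceCertificate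
open scoped ComplexOrder BigOperators

/-- The box-averaged torus LRO sequence is bounded above at every positive side by the crude constant `C_g²`
(`pairFieldCorr_succ_le`, unit vectors). [cite: Scalapino1995, §2 eq. (2.4)] -/
theorem torusLROSeq_le_const (g : Site 2 → ℝ) (ψ : ∀ L, Fock (Orb (FermionTorus 2 L))) (n : ℕ)
    (hψ : star (ψ (n + 1)) ⬝ᵥ ψ (n + 1) = 1) :
    (∑ x ∈ halfOpenBox 2 (n + 1), ∑ y ∈ halfOpenBox 2 (n + 1), torusPullback (pairFieldCorr g ψ) (n + 1) x y) /
        ((#(halfOpenBox 2 (n + 1)) : ℝ)) ^ 2 ≤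
      (∑ e ∈ insert 0 unitSteps, ‖((g e / Real.sqrt 2 : ℝ) : ℂ)‖ * 2) ^ 2 := by
  set C := (∑ e ∈ insert 0 unitSteps, ‖((g e / Real.sqrt 2 : ℝ) : ℂ)‖ * 2) ^ 2 with hC
  have hpt : ∀ x ∈ halfOpenBox 2 (n + 1), ∀ y ∈ halfOpenBox 2 (n + 1),
      torusPullback (pairFieldCorr g ψ) (n + 1) x y ≤ C := fun x _ y _ => by
    rw [torusPullback_apply]
    exact pairFieldCorr_succ_le g ψ n hψ _ _
  have hsum : (∑ x ∈ halfOpenBox 2 (n + 1), ∑ y ∈ halfOpenBox 2 (n + 1), torusPullback (pairFieldCorr g ψ) (n + 1) x y) ≤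
      (((#(halfOpenBox 2 (n + 1)) : ℝ)) ^ 2) * C := by
    calc (∑ x ∈ halfOpenBox 2 (n + 1), ∑ y ∈ halfOpenBox 2 (n + 1), torusPullback (pairFieldCorr g ψ) (n + 1) x y)
        ≤ ∑ x ∈ halfOpenBox 2 (n + 1), ∑ y ∈ halfOpenBox 2 (n + 1), C :=
          Finset.sum_le_sum fun x hx => Finset.sum_le_sum fun y hy => hpt x hx y hy
      _ = (((#(halfOpenBox 2 (n + 1)) : ℝ)) ^ 2) * C := by
          rw [Finset.sum_const, Finset.sum_const, smul_smul, nsmul_eq_mul]; push_cast; ring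
  have hpos : 0 < (((#(halfOpenBox 2 (n + 1)) : ℝ)) ^ 2) := by
    rw [card_halfOpenBox]; positivity
  rw [div_le_iff₀ hpos]
  linarith

/-- **The D59 bearing as an implication**: the summit-format ODLRO leaf at any `c' ≤ 1/200` implies the route item `StripePointCeiling`
(Theses/AbsenceCertificate.lean, stmt-HubbardSuperconductivity-9492). [cite: Scalapino1995, §2 eq. (2.4)] -/
theorem stripePointCeiling_of_pairLROCeilingAt {c' : ℚ} (h : M3ObsPairLROCeilingAt_tp0 c') (hc' : ((c' : ℚ) : ℝ) ≤ 1 / 200) :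
    StripePointCeiling := by
  classical
  intro N ψ hadm c hc
  obtain ⟨L₀, hev⟩ := hc
  -- complete the admissible (even-`L`) family by unit sector ground states at the other sides
  have hn2 : (7 / 8 : ℝ) ≤ 2 := by norm_num
  let ψ' : ∀ L, Fock (Orb (FermionTorus 2 L)) := fun L =>
    if Even L then ψ L else Classical.choose (InfVolFermionState.exists_unit_isGroundStateInSector_rectN 1 8 hn2 L)
  have hrect : ∀ L : ℕ, rectN (7 / 8) L = 2 * ⌊(1 - 1 / 8) * (L : ℝ) ^ 2 / 2⌋₊ := fun L => by
    norm_num [rectN]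
  have hψ'1 : ∀ L, star (ψ' L) ⬝ᵥ ψ' L = 1 := by
    intro L
    by_cases hL : Even L
    · simp only [ψ', hL, if_true]; exact (hadm L hL).2.1
    · simp only [ψ', hL, if_false]
      exact (Classical.choose_spec (InfVolFermionState.exists_unit_isGroundStateInSector_rectN 1 8 hn2 L)).1
  have hψ'gs : ∀ L, IsGroundStateInSector (hubbardTorusTT' L 1 0 8) (rectN (7 / 8) L) 0 (ψ' L) := by
    intro L
    rw [hubbardTorusTT'_zero]
    by_cases hL : Even L
    · simp only [ψ', hL, if_true]
      rw [hrect L, ← (hadm L hL).1]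
      exact (hadm L hL).2.2
    · simp only [ψ', hL, if_false]
      exact (Classical.choose_spec (InfVolFermionState.exists_unit_isGroundStateInSector_rectN 1 8 hn2 L)).2
  have hlim := h ψ' hψ'gs hψ'1
  -- the LRO sequences of `ψ` and `ψ'` agree (even sides only enter)
  set u : ℕ → ℝ := fun k => (∑ x ∈ halfOpenBox 2 (2 * k), ∑ y ∈ halfOpenBox 2 (2 * k),
      torusPullback (pairFieldCorr dWaveFormFactor ψ') (2 * k) x y) / ((#(halfOpenBox 2 (2 * k)) : ℝ)) ^ 2 with hu
  change liminf u atTop ≤ ((c' : ℚ) : ℝ) at hlim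
  have heq : ∀ k, ψ' (2 * k) = ψ (2 * k) := fun k => by simp only [ψ', even_two_mul, if_true]
  -- eventually `c ≤ u k`
  have hev' : ∀ᶠ k : ℕ in atTop, c ≤ u k := by
    filter_upwards [Filter.eventually_ge_atTop (L₀ + 1)] with k hk
    have hk1 : 1 ≤ k := by omega
    obtain ⟨n, hn⟩ : ∃ n, 2 * k = n + 1 := ⟨2 * k - 1, by omega⟩
    have hterm : u k = (expect ((pairField dWaveFormFactor (n + 1))ᴴ * pairField dWaveFormFactor (n + 1)) (ψ (n + 1))).re /
        (((n + 1 : ℕ) : ℝ)) ^ 4 := by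
      have hψeq : ψ' (n + 1) = ψ (n + 1) := by rw [← hn]; exact heq k
      simp only [hu]
      rw [hn, torusLROSeq_pairFieldCorr_succ, hψeq]
    haveI : NeZero (n + 1) := ⟨Nat.succ_ne_zero n⟩
    have hevenn : Even (n + 1) := by rw [← hn]; exact even_two_mul k
    have hc1 := hev (n + 1) hevenn (by omega)
    rw [hterm, le_div_iff₀ (by positivity)]
    simpa using hc1
  -- the sequence is bounded above (honest liminf)
  have hbdd : ∀ᶠ k : ℕ in atTop, u k ≤ (∑ e ∈ insert 0 unitSteps, ‖((dWaveFormFactor e / Real.sqrt 2 : ℝ) : ℂ)‖ * 2) ^ 2 := by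
    filter_upwards [Filter.eventually_ge_atTop 1] with k hk
    obtain ⟨n, hn⟩ : ∃ n, 2 * k = n + 1 := ⟨2 * k - 1, by omega⟩
    simp only [hu]
    rw [hn]
    exact torusLROSeq_le_const dWaveFormFactor ψ' n (hψ'1 (n + 1))
  have hco : IsCoboundedUnder (· ≥ ·) atTop u := Filter.isCoboundedUnder_ge_of_eventually_le atTop hbdd
  have hcl : c ≤ liminf u atTop := le_liminf_of_le hco hev'
  have := hcl.trans (hlim.trans hc')
  exact this

/-- **Any certified `F₂`-type `D₄`-orbit cell with `−q/|B|² ≤ 1/200` discharges `StripePointCeiling`** (modulo the claim nodes fed in as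
`h`, the cap cell `hE`): `M3ObsPairLROCeilingAt_tp0_of_orbitRow` (p405736; p405359 inside) + `stripePointCeiling_of_pairLROCeilingAt`.
[cite: Scalapino1995, §2 eq. (2.4)] -/
theorem stripePointCeiling_of_orbitRow {u hi q : ℚ} {B : Finset (Site 2)} (hB : B.Nonempty)
    (h : M3CorrOrbitLowerRow 0 u q Finset.univ (B.biUnion (pairRegion (insert (0 : Site 2) unitSteps)))
      (-pairBoxWord (insert (0 : Site 2) unitSteps) dWaveFormFactor B))
    (hE : M3EnergyUpperRow 0 hi) (hhi : hi ≤ u) (hq : -((q : ℚ) : ℝ) / ((B.card : ℝ)) ^ 2 ≤ 1 / 200) :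
    StripePointCeiling :=
  stripePointCeiling_of_pairLROCeilingAt (c' := 1 / 200) (M3ObsPairLROCeilingAt_tp0_of_orbitRow hB h hE hhi (by push_cast; linarith))
    (by push_cast; norm_num)

end Summit.Ventures.CertifiedManyBodySolver.Observables

end
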